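import Literature.MathematicalPhysics.KineticTheory.HardSphereBBGKYLiouvilleWindow
import Literature.Analysis.FluidPDE.BoltzmannGradLimitProofs
import HarnessLib

/-!
# The marginal along the tagged flow: weak form and the integrated Lipschitz estimate

Fourth file of the proof of `Literature.MathematicalPhysics.KineticTheory.bbgky_hierarchy_of_liouville`
(**hilbert6.S07**; plan in `HardSphereBBGKYLiouvilleFlow`). On the flat torus let `Φs`, `ΦN` be
hard-sphere flows of `s` and `s + m` particles, `W` an initial `(s+m)`-particle density and
`f_N(t) = 1_{good} · W ∘ ΦN_{-t}` its transport. The honest `s`-particle marginal read along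
the tagged flow, `u(t, Y) = f_N^{(s)}(t)(Φs_t Y)` (`f^{(s)} = nthMarginal (s+m) s`), is the
quantity whose time-regularity the mild BBGKY hierarchy expresses. Here:

* `setIntegral_marginal_flow_eq` (§1, **weak form**): for measurable `B ⊆ good_s`,
  `∫_B u(t) dY = ∫_{good_N} W(z₀) 1_{Φs_t(B)}(tagged ΦN_t z₀) dz₀` — two Liouville substitutions
  (`HardSphereFlow.measurePreserving_restrict_good`) around Fubini for the marginal
  (`integral_mul_nthMarginal`).
* §2, **dynamics of the indicator**: if between `t₁` and `t₂` the `(s+m)`-orbit of `z₀` has no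
  tagged–untagged contact (and its tagged part at `t₁` is good), the indicator
  `1_{Φs_t(B)}(tagged ΦN_t z₀)` is the same at `t₁` and `t₂` (`HardSphereFlow.tagged_flow_eq_of_flow`:
  the tagged part follows `Φs`); and if it has such a contact, then at both ends of the window the
  configuration lies in the collision window set of duration `t₂ - t₁`
  (`HardSphereFlow.euclidDist_flow_le_of_contact`).
* §3, **Fubini over tagged/untagged particles** (`volume_preserving_appendMEquiv`) turns the
  Gaussian volume of the window (`lintegral_window_le`) into the bound
  `∫ 1_{B'}(tagged z) 1_{window}(z) e^{-βE(z)} dz ≤ h A ∫_{B'} e^{-βE/2}`, and shows that the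
  data whose tagged part is not good form a null set.
* `abs_setIntegral_marginal_flow_sub_le` (§4, **the integrated Lipschitz estimate**): for
  `|W| ≤ C_W e^{-βE}` and measurable `B ⊆ good_s`,
  `|∫_B (u(t₂) - u(t₁)) dY| ≤ 2 C_W A (t₂ - t₁) ∫_B e^{-βE(Y)/2} dY`.
  This is the (soft, inequality) form of the flux of `f_N(t)` through the tagged–untagged
  collision surfaces in CIP 1994 App. 4.B / Spohn 2006 Prop. 1, which is all the proof of the
  hierarchy *as stated* needs (`HardSphereBBGKYLiouvilleFlow`, plan).

Theorems only; no definition and no named fact is introduced.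

## References

* C. Cercignani, R. Illner, M. Pulvirenti, *The Mathematical Theory of Dilute Gases*, Springer
  (1994), §4.3, App. 4.B ((B.2)–(B.5): the time derivative of `∫ u_s P(t)` is a boundary flux).
* H. Spohn, *On the integrated form of the BBGKY hierarchy for hard spheres*,
  arXiv:math-ph/0605068, Prop. 1 (telescoping over tagged–untagged collisions).
* I. Gallagher, L. Saint-Raymond, B. Texier, *From Newton to Boltzmann*, EMS (2013),
  arXiv:1208.5753, §4.3.
-/

open MeasureTheory Set Filter Topology Metric
open scoped ENNReal

namespace Literature.MathematicalPhysics.KineticTheory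

open Literature.Analysis.FluidPDE

noncomputable section

variable {d : Type*} [Fintype d]

section Torus

variable {ε β CW : ℝ} {s m : ℕ}

/-! ## §0. Measurability and integrability of the transported density and its marginal -/

/-- The transported density `1_{good} · W ∘ Φ_{-t}` is measurable for measurable `W`. [folklore] -/
theorem measurable_indicator_transport {X : Type*} [MeasureSpace X] [TopologicalSpace X]
    {G : Geometry d X} {n : ℕ} (Φ : HardSphereFlow G ε n) {W : Config n d X → ℝ}
    (hW : Measurable W) (t : ℝ) : Measurable (Φ.good.indicator fun z => W (Φ.flow (-t) z)) :=
  (hW.comp (Φ.measurable_flow (-t))).indicator Φ.measurableSet_good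

/-- The transported density `1_{good} · W ∘ Φ_{-t}` is integrable for integrable `W`
(Liouville substitution on the good set). [folklore] -/
theorem integrable_indicator_transport {X : Type*} [MeasureSpace X] [TopologicalSpace X]
    {G : Geometry d X} {n : ℕ} (Φ : HardSphereFlow G ε n) {W : Config n d X → ℝ}
    (hW : Measurable W) (hWi : Integrable W) (t : ℝ) :
    Integrable (Φ.good.indicator fun z => W (Φ.flow (-t) z)) := by
  rw [integrable_indicator_iff Φ.measurableSet_good]
  have h := (Φ.measurePreserving_restrict_good (-t)).integrable_comp hW.aestronglyMeasurable
  exact h.2 (hWi.mono_measure Measure.restrict_le_self)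

/-- The integral of `|1_{good} · W ∘ Φ_{-t}|` is at most that of `|W|`. [folklore] -/
theorem integral_abs_indicator_transport_le {X : Type*} [MeasureSpace X] [TopologicalSpace X]
    {G : Geometry d X} {n : ℕ} (Φ : HardSphereFlow G ε n) {W : Config n d X → ℝ}
    (hW : Measurable W) (hWi : Integrable W) (t : ℝ) :
    ∫ z, |Φ.good.indicator (fun z => W (Φ.flow (-t) z)) z| ≤ ∫ z, |W z| := by
  have habs : (fun z => |Φ.good.indicator (fun z => W (Φ.flow (-t) z)) z|) =
      Φ.good.indicator fun z => |W (Φ.flow (-t) z)| := by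
    funext z
    by_cases hz : z ∈ Φ.good
    · simp [indicator_of_mem hz]
    · simp [indicator_of_notMem hz]
  rw [habs, integral_indicator Φ.measurableSet_good]
  have hmp := Φ.measurePreserving_restrict_good (-t)
  have h1 : ∫ z in Φ.good, |W (Φ.flow (-t) z)| = ∫ z in Φ.good, |W z| := by
    have := integral_map (μ := volume.restrict Φ.good) (hmp.measurable.aemeasurable)
      (f := fun z => |W z|) (hW.norm.aestronglyMeasurable)
    rw [hmp.map_eq] at this
    simpa [Real.norm_eq_abs] using this.symm
  rw [h1]
  exact setIntegral_le_integral hWi.abs (Eventually.of_forall fun z => abs_nonneg _)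

/-! ## §1. The weak form -/

/-- Images of good subsets under the flow are measurable subsets of the good set. [folklore] -/
theorem _root_.Literature.Analysis.FluidPDE.HardSphereFlow.measurableSet_image_flow
    {X : Type*} [MeasureSpace X] [TopologicalSpace X] {G : Geometry d X} {n : ℕ}
    (Φ : HardSphereFlow G ε n) (t : ℝ) {B : Set (Config n d X)} (hB : MeasurableSet B)
    (hBg : B ⊆ Φ.good) : MeasurableSet (Φ.flow t '' B) := by
  rw [Φ.image_eq_preimage_of_subset_good t hBg]
  exact (Φ.measurable_flow (-t) hB).inter Φ.measurableSet_good

/-- Liouville substitution for integrals on the good set: `∫_{good} g ∘ Φ_t = ∫_{good} g`. [folklore] -/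
theorem _root_.Literature.Analysis.FluidPDE.HardSphereFlow.setIntegral_comp_flow
    {X : Type*} [MeasureSpace X] [TopologicalSpace X] {G : Geometry d X} {n : ℕ}
    (Φ : HardSphereFlow G ε n) (t : ℝ) {g : Config n d X → ℝ} (hg : Measurable g) :
    ∫ z in Φ.good, g (Φ.flow t z) = ∫ z in Φ.good, g z := by
  have hmp := Φ.measurePreserving_restrict_good t
  have := integral_map (μ := volume.restrict Φ.good) hmp.measurable.aemeasurable
    (f := g) hg.aestronglyMeasurable
  rw [hmp.map_eq] at this
  exact this.symm

/-- The indicator of `B` read before the flow is the indicator of `Φ_t(B)` read after it, on the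
good set (`Φ_t` is injective there). [folklore] -/
theorem _root_.Literature.Analysis.FluidPDE.HardSphereFlow.indicator_image_flow
    {X : Type*} [MeasureSpace X] [TopologicalSpace X] {G : Geometry d X} {n : ℕ}
    (Φ : HardSphereFlow G ε n) (t : ℝ) {B : Set (Config n d X)} (hBg : B ⊆ Φ.good)
    (g : Config n d X → ℝ) {Y : Config n d X} (hY : Y ∈ Φ.good) :
    (Φ.flow t '' B).indicator g (Φ.flow t Y) = B.indicator (fun Y => g (Φ.flow t Y)) Y := by
  by_cases hYB : Y ∈ B
  · rw [indicator_of_mem hYB, indicator_of_mem (mem_image_of_mem _ hYB)]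
  · rw [indicator_of_notMem hYB, indicator_of_notMem]
    rintro ⟨Y', hY'B, hYY'⟩
    exact hYB ((Φ.injOn_flow t (hBg hY'B) hY hYY') ▸ hY'B)

/-- **Weak form of the marginal along the tagged flow.** For measurable `B ⊆ good_s` and any
`t`, `∫_B f_N^{(s)}(t)(Φs_t Y) dY = ∫_{good_N} 1_{Φs_t(B)}(tagged (ΦN_t z₀)) W(z₀) dz₀`, where
`f_N(t) = 1_{good_N} · W ∘ ΦN_{-t}`: substitute `X = Φs_t Y` (Liouville for `Φs`), Fubini for
the marginal (`integral_mul_nthMarginal`), substitute `z₀ = ΦN_{-t} z` (Liouville for `ΦN`).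
This is the weak formulation of GST 2013 §4.2–4.3 with the test function `1_B ∘ Φs_{-t}`. [cite: GST2013, §4.3] -/
theorem setIntegral_marginal_flow_eq (Φs : HardSphereFlow (Torus.geometry d) ε s)
    (ΦN : HardSphereFlow (Torus.geometry d) ε (s + m)) {W : Config (s + m) d (UnitAddTorus d) → ℝ}
    (hW : Measurable W) (hWi : Integrable W) (t : ℝ) {B : Set (Config s d (UnitAddTorus d))}
    (hB : MeasurableSet B) (hBg : B ⊆ Φs.good) :
    ∫ Y in B, nthMarginal (s + m) s (ΦN.good.indicator fun z => W (ΦN.flow (-t) z)) (Φs.flow t Y) =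
      ∫ z in ΦN.good, (Φs.flow t '' B).indicator (1 : Config s d (UnitAddTorus d) → ℝ)
        (ΦN.flow t z ∘ Fin.castAdd m) * W z := by
  have hle : s ≤ s + m := Nat.le_add_right s m
  have hρm : Measurable (ΦN.good.indicator fun z => W (ΦN.flow (-t) z)) :=
    measurable_indicator_transport ΦN hW t
  have hρi : Integrable (ΦN.good.indicator fun z => W (ΦN.flow (-t) z)) :=
    integrable_indicator_transport ΦN hW hWi t
  have hfs : Measurable (nthMarginal (s + m) s (ΦN.good.indicator fun z => W (ΦN.flow (-t) z))) :=
    measurable_nthMarginal _ _ hρm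
  have hBt : MeasurableSet (Φs.flow t '' B) := Φs.measurableSet_image_flow t hB hBg
  have hBtg : Φs.flow t '' B ⊆ Φs.good := by
    rintro _ ⟨Y, hY, rfl⟩; exact Φs.mapsTo_good t (hBg hY)
  -- Step 1: substitute `X = Φs_t Y`
  have h1 : ∫ Y in B, nthMarginal (s + m) s (ΦN.good.indicator fun z => W (ΦN.flow (-t) z))
        (Φs.flow t Y) =
      ∫ X in Φs.flow t '' B, nthMarginal (s + m) s (ΦN.good.indicator fun z => W (ΦN.flow (-t) z)) X := by
    have hBB : B = Φs.good ∩ B := (inter_eq_right.2 hBg).symm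
    calc ∫ Y in B, nthMarginal (s + m) s (ΦN.good.indicator fun z => W (ΦN.flow (-t) z)) (Φs.flow t Y)
        = ∫ Y in Φs.good, B.indicator (fun Y => nthMarginal (s + m) s
            (ΦN.good.indicator fun z => W (ΦN.flow (-t) z)) (Φs.flow t Y)) Y := by
          rw [setIntegral_indicator hB, ← hBB]
      _ = ∫ Y in Φs.good, (Φs.flow t '' B).indicator
            (nthMarginal (s + m) s (ΦN.good.indicator fun z => W (ΦN.flow (-t) z))) (Φs.flow t Y) := by
          refine setIntegral_congr_fun Φs.measurableSet_good fun Y hY => ?_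
          exact (Φs.indicator_image_flow t hBg _ hY).symm
      _ = ∫ X in Φs.good, (Φs.flow t '' B).indicator
            (nthMarginal (s + m) s (ΦN.good.indicator fun z => W (ΦN.flow (-t) z))) X :=
          Φs.setIntegral_comp_flow t (hfs.indicator hBt)
      _ = ∫ X in Φs.flow t '' B, nthMarginal (s + m) s (ΦN.good.indicator fun z => W (ΦN.flow (-t) z)) X := by
          rw [setIntegral_indicator hBt, inter_eq_right.2 hBtg]
  -- Step 2: Fubini for the marginal
  have h2 : ∫ X in Φs.flow t '' B, nthMarginal (s + m) s (ΦN.good.indicator fun z => W (ΦN.flow (-t) z)) X =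
      ∫ z, (Φs.flow t '' B).indicator (1 : Config s d (UnitAddTorus d) → ℝ) (fun i => z (Fin.castLE hle i)) *
        ΦN.good.indicator (fun z => W (ΦN.flow (-t) z)) z := by
    rw [integral_mul_nthMarginal hle hρi (measurable_one.indicator hBt) (C := 1) (fun zs => by
      by_cases h : zs ∈ Φs.flow t '' B <;> simp [h])]
    rw [← integral_indicator hBt]
    refine integral_congr_ae (Eventually.of_forall fun X => ?_)
    by_cases h : X ∈ Φs.flow t '' B <;> simp [h]
  -- Step 3: substitute `z₀ = ΦN_{-t} z`
  have h3 : ∫ z, (Φs.flow t '' B).indicator (1 : Config s d (UnitAddTorus d) → ℝ) (fun i => z (Fin.castLE hle i)) *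
        ΦN.good.indicator (fun z => W (ΦN.flow (-t) z)) z =
      ∫ z in ΦN.good, (Φs.flow t '' B).indicator (1 : Config s d (UnitAddTorus d) → ℝ)
        (ΦN.flow t z ∘ Fin.castAdd m) * W z := by
    have hprod : (fun z => (Φs.flow t '' B).indicator (1 : Config s d (UnitAddTorus d) → ℝ)
          (fun i => z (Fin.castLE hle i)) * ΦN.good.indicator (fun z => W (ΦN.flow (-t) z)) z) =
        ΦN.good.indicator fun z => (Φs.flow t '' B).indicator (1 : Config s d (UnitAddTorus d) → ℝ)
          (fun i => z (Fin.castLE hle i)) * W (ΦN.flow (-t) z) := by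
      funext z
      by_cases hz : z ∈ ΦN.good
      · simp [indicator_of_mem hz]
      · simp [indicator_of_notMem hz]
    rw [hprod, integral_indicator ΦN.measurableSet_good]
    -- on the good set, `z = ΦN_t (ΦN_{-t} z)`
    have hg : Measurable fun z₀ : Config (s + m) d (UnitAddTorus d) =>
        (Φs.flow t '' B).indicator (1 : Config s d (UnitAddTorus d) → ℝ) (ΦN.flow t z₀ ∘ Fin.castAdd m) * W z₀ := by
      refine Measurable.mul ?_ hW
      exact (measurable_one.indicator hBt).comp
        ((measurable_pi_lambda _ fun i => (measurable_pi_apply _).comp (ΦN.measurable_flow t)))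
    have key := ΦN.setIntegral_comp_flow (-t) hg
    rw [← key]
    refine setIntegral_congr_fun ΦN.measurableSet_good fun z hz => ?_
    simp only [ΦN.flow_flow_neg t hz]
    rfl
  rw [h1, h2, h3]

/-! ## §2. Dynamics of the indicator between two times -/

/-- The image of `B` at time `t₂` is the image at time `t₂ - t₁` of the image at time `t₁`
(group property on the good set). [folklore] -/
theorem _root_.Literature.Analysis.FluidPDE.HardSphereFlow.mem_image_flow_iff
    {X : Type*} [MeasureSpace X] [TopologicalSpace X] {G : Geometry d X} {n : ℕ}
    (Φ : HardSphereFlow G ε n) {B : Set (Config n d X)} (hBg : B ⊆ Φ.good) (t₁ t₂ : ℝ)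
    {X₁ : Config n d X} (hX₁ : X₁ ∈ Φ.good) :
    Φ.flow (t₂ - t₁) X₁ ∈ Φ.flow t₂ '' B ↔ X₁ ∈ Φ.flow t₁ '' B := by
  constructor
  · rintro ⟨Y, hY, hYe⟩
    refine ⟨Y, hY, ?_⟩
    have hYg := hBg hY
    have h1 : Φ.flow t₂ Y = Φ.flow (t₂ - t₁) (Φ.flow t₁ Y) := by
      rw [← Φ.flow_add (t₂ - t₁) t₁ Y hYg, sub_add_cancel]
    rw [h1] at hYe
    exact Φ.injOn_flow (t₂ - t₁) (Φ.mapsTo_good t₁ hYg) hX₁ hYe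
  · rintro ⟨Y, hY, rfl⟩
    refine ⟨Y, hY, ?_⟩
    rw [← Φ.flow_add (t₂ - t₁) t₁ Y (hBg hY), sub_add_cancel]

/-- **No tagged–untagged contact: the indicator does not change.** If `z₀` is good, the tagged
part of `ΦN_{t₁} z₀` is good for `Φs`, and on `(t₁, t₂]` every contact of the orbit of `z₀` is
tagged–tagged or untagged–untagged, then `1_{Φs_{t₂}(B)}(tagged ΦN_{t₂} z₀) =
1_{Φs_{t₁}(B)}(tagged ΦN_{t₁} z₀)` for every `B ⊆ good_s` (`HardSphereFlow.tagged_flow_eq_of_flow`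
and the group property). [folklore] -/
theorem indicator_image_tagged_eq (Φs : HardSphereFlow (Torus.geometry d) ε s)
    (ΦN : HardSphereFlow (Torus.geometry d) ε (s + m)) {B : Set (Config s d (UnitAddTorus d))}
    (hBg : B ⊆ Φs.good) {z₀ : Config (s + m) d (UnitAddTorus d)} (hz₀ : z₀ ∈ ΦN.good)
    {t₁ t₂ : ℝ} (h12 : t₁ ≤ t₂) (hX₁ : (ΦN.flow t₁ z₀ ∘ Fin.castAdd m : Config s d (UnitAddTorus d)) ∈ Φs.good)
    (hnc : ∀ τ ∈ Ioc t₁ t₂, ∀ I J : Fin (s + m), I ≠ J →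
      ΦN.flow τ z₀ ∈ contactSet (Torus.geometry d) (s + m) ε I J → ((I : ℕ) < s ↔ (J : ℕ) < s)) :
    (Φs.flow t₂ '' B).indicator (1 : Config s d (UnitAddTorus d) → ℝ) (ΦN.flow t₂ z₀ ∘ Fin.castAdd m) =
      (Φs.flow t₁ '' B).indicator (1 : Config s d (UnitAddTorus d) → ℝ) (ΦN.flow t₁ z₀ ∘ Fin.castAdd m) := by
  have key := HardSphereFlow.tagged_flow_eq_of_flow Torus.continuous_geometry_translate Φs ΦN hz₀ t₁ hX₁
    (h := t₂ - t₁) (fun τ hτ I J hIJ hc => hnc τ ⟨hτ.1, by linarith [hτ.2]⟩ I J hIJ hc)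
    (t₂ - t₁) ⟨sub_nonneg.2 h12, le_rfl⟩
  rw [add_sub_cancel] at key
  rw [key]
  have hiff := Φs.mem_image_flow_iff hBg t₁ t₂ hX₁ (B := B)
  by_cases hmem : (ΦN.flow t₁ z₀ ∘ Fin.castAdd m : Config s d (UnitAddTorus d)) ∈ Φs.flow t₁ '' B
  · rw [indicator_of_mem hmem, indicator_of_mem (hiff.2 hmem)]
    rfl
  · rw [indicator_of_notMem hmem, indicator_of_notMem (fun h => hmem (hiff.1 h))]

/-- **A tagged–untagged contact puts both ends of the window in the collision window set.** If
the orbit of a good `z₀` has, at some `τ ∈ (t₁, t₂]`, a contact between a tagged and an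
untagged particle, then at time `t₁` and at time `t₂` some tagged–untagged pair is at distance
in `[ε, ε + 2(t₂ - t₁)√(2E)]` (`HardSphereFlow.euclidDist_flow_le_of_contact`). [folklore] -/
theorem mem_window_of_contact (ΦN : HardSphereFlow (Torus.geometry d) ε (s + m))
    {z₀ : Config (s + m) d (UnitAddTorus d)} (hz₀ : z₀ ∈ ΦN.good) {t₁ t₂ τ : ℝ} (hτ : τ ∈ Icc t₁ t₂)
    {I J : Fin (s + m)} (hIJ : I ≠ J) (hc : ΦN.flow τ z₀ ∈ contactSet (Torus.geometry d) (s + m) ε I J)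
    (htu : ¬ ((I : ℕ) < s ↔ (J : ℕ) < s)) {t : ℝ} (ht : t ∈ Icc t₁ t₂) :
    ∃ (i : Fin s) (j : Fin m),
      ε ≤ Torus.euclidDist (ΦN.flow t z₀ (Fin.castAdd m i)).1 (ΦN.flow t z₀ (Fin.natAdd s j)).1 ∧
        Torus.euclidDist (ΦN.flow t z₀ (Fin.castAdd m i)).1 (ΦN.flow t z₀ (Fin.natAdd s j)).1 ≤
          ε + 2 * (t₂ - t₁) * Real.sqrt (2 * configEnergy (ΦN.flow t z₀)) := by
  have hb := ΦN.euclidDist_flow_le_of_contact hz₀ hIJ hc t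
  rw [ΦN.configEnergy_flow hz₀ t]
  have habs : |t - τ| ≤ t₂ - t₁ := by
    rw [abs_le]; constructor <;> linarith [ht.1, ht.2, hτ.1, hτ.2]
  have hV : 0 ≤ 2 * Real.sqrt (2 * configEnergy z₀) := by positivity
  have hub : Torus.euclidDist (ΦN.flow t z₀ I).1 (ΦN.flow t z₀ J).1 ≤
      ε + 2 * (t₂ - t₁) * Real.sqrt (2 * configEnergy z₀) := by
    calc _ ≤ ε + 2 * Real.sqrt (2 * configEnergy z₀) * |t - τ| := hb.2
      _ ≤ ε + 2 * Real.sqrt (2 * configEnergy z₀) * (t₂ - t₁) := by gcongr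
      _ = _ := by ring
  rcases eq_castAdd_or_eq_natAdd I with ⟨i, rfl⟩ | ⟨j, rfl⟩
  · rcases eq_castAdd_or_eq_natAdd J with ⟨i', rfl⟩ | ⟨j, rfl⟩
    · exact absurd (iff_of_true (by simp) (by simp)) htu
    · exact ⟨i, j, hb.1, hub⟩
  · rcases eq_castAdd_or_eq_natAdd J with ⟨i, rfl⟩ | ⟨j', rfl⟩
    · refine ⟨i, j, ?_, ?_⟩
      · rw [Torus.euclidDist_comm]; exact hb.1
      · rw [Torus.euclidDist_comm]; exact hub
    · exact absurd (iff_of_false (by simp) (by simp)) htu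

/-! ## §3. Fubini over tagged and untagged particles -/

/-- **Gaussian volume of the window, localised in the tagged part.** For measurable
`B' ⊆ Config s` and `h ≥ 0`,
`∫ 1_{B'}(tagged z) 1_{window_h}(z) e^{-βE(z)} dz ≤ h A ∫_{B'} e^{-βE(X)/2} dX`
(`volume_preserving_appendMEquiv`, `lintegral_window_le`). [folklore] -/
theorem lintegral_tagged_window_le (hε : 0 < ε) (hε2 : ε ≤ 1 / 2) (hβ : 0 < β) (s m : ℕ) :
    ∃ A : ℝ, 0 ≤ A ∧ ∀ h : ℝ, 0 ≤ h → ∀ B' : Set (Config s d (UnitAddTorus d)), MeasurableSet B' →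
      ∫⁻ z : Config (s + m) d (UnitAddTorus d),
          B'.indicator (1 : Config s d (UnitAddTorus d) → ℝ≥0∞) (z ∘ Fin.castAdd m) *
            {z : Config (s + m) d (UnitAddTorus d) | ∃ (i : Fin s) (j : Fin m),
              ε ≤ Torus.euclidDist (z (Fin.castAdd m i)).1 (z (Fin.natAdd s j)).1 ∧
                Torus.euclidDist (z (Fin.castAdd m i)).1 (z (Fin.natAdd s j)).1 ≤
                  ε + 2 * h * Real.sqrt (2 * configEnergy z)}.indicator
              (fun z => ENNReal.ofReal (Real.exp (-β * configEnergy z))) z ≤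
        ENNReal.ofReal (h * A) * ∫⁻ X in B', ENNReal.ofReal (Real.exp (-(β / 2) * configEnergy X)) := by
  classical
  obtain ⟨A, hA0, hA⟩ := lintegral_window_le (d := d) hε hε2 hβ s m
  refine ⟨A, hA0, fun h hh B' hB' => ?_⟩
  have hmp := volume_preserving_appendMEquiv (UnitAddTorus d × EuclideanSpace ℝ d) s m
  -- the integrand
  obtain ⟨F, hF⟩ : ∃ F : Config (s + m) d (UnitAddTorus d) → ℝ≥0∞, F = fun z =>
      B'.indicator (1 : Config s d (UnitAddTorus d) → ℝ≥0∞) (z ∘ Fin.castAdd m) *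
        {z : Config (s + m) d (UnitAddTorus d) | ∃ (i : Fin s) (j : Fin m),
          ε ≤ Torus.euclidDist (z (Fin.castAdd m i)).1 (z (Fin.natAdd s j)).1 ∧
            Torus.euclidDist (z (Fin.castAdd m i)).1 (z (Fin.natAdd s j)).1 ≤
              ε + 2 * h * Real.sqrt (2 * configEnergy z)}.indicator
          (fun z => ENNReal.ofReal (Real.exp (-β * configEnergy z))) z := ⟨_, rfl⟩
  -- evaluation on juxtaposed configurations
  have hFapp : ∀ (Xs : Config s d (UnitAddTorus d)) (Zm : Config m d (UnitAddTorus d)),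
      F (Fin.append Xs Zm) = B'.indicator (1 : Config s d (UnitAddTorus d) → ℝ≥0∞) Xs *
        {Zm : Config m d (UnitAddTorus d) | ∃ (i : Fin s) (j : Fin m),
          ε ≤ Torus.euclidDist (Xs i).1 (Zm j).1 ∧
            Torus.euclidDist (Xs i).1 (Zm j).1 ≤
              ε + 2 * h * Real.sqrt (2 * configEnergy (Fin.append Xs Zm))}.indicator
          (fun Zm => ENNReal.ofReal (Real.exp (-β * configEnergy (Fin.append Xs Zm)))) Zm := by
    intro Xs Zm
    rw [hF]
    simp only
    have htag : (Fin.append Xs Zm ∘ Fin.castAdd m : Config s d (UnitAddTorus d)) = Xs := by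
      funext i; simp
    rw [htag]
    congr 1
    simp only [indicator, mem_setOf_eq, Fin.append_left, Fin.append_right]
  haveI : SigmaFinite (volume : Measure (UnitAddTorus d × EuclideanSpace ℝ d)) := inferInstance
  haveI : SigmaFinite (volume : Measure (Config s d (UnitAddTorus d))) := inferInstance
  haveI : SigmaFinite (volume : Measure (Config m d (UnitAddTorus d))) := inferInstance
  calc _ = ∫⁻ z, F z := by rw [hF]
    _ = ∫⁻ p : Config s d (UnitAddTorus d) × Config m d (UnitAddTorus d), F (Fin.append p.1 p.2)
        ∂((volume : Measure (Config s d (UnitAddTorus d))).prod (volume : Measure (Config m d (UnitAddTorus d)))) := by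
        rw [← hmp.lintegral_comp_emb (MeasurableEquiv.measurableEmbedding _)]
        simp only [appendMEquiv_apply]
    _ = ∫⁻ Xs : Config s d (UnitAddTorus d), ∫⁻ Zm : Config m d (UnitAddTorus d), F (Fin.append Xs Zm) := by
        refine lintegral_prod _ ?_
        have hFm : Measurable F := by
          rw [hF]
          refine Measurable.mul ?_ ?_
          · exact (measurable_one.indicator hB').comp (measurable_pi_lambda _ fun i => measurable_pi_apply _)
          · refine Measurable.indicator (ENNReal.measurable_ofReal.comp (by unfold configEnergy; fun_prop)) ?_
            have hW' : {z : Config (s + m) d (UnitAddTorus d) | ∃ (i : Fin s) (j : Fin m),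
                ε ≤ Torus.euclidDist (z (Fin.castAdd m i)).1 (z (Fin.natAdd s j)).1 ∧
                  Torus.euclidDist (z (Fin.castAdd m i)).1 (z (Fin.natAdd s j)).1 ≤
                    ε + 2 * h * Real.sqrt (2 * configEnergy z)} =
                ⋃ (i : Fin s) (j : Fin m), {z | ε ≤ Torus.euclidDist (z (Fin.castAdd m i)).1 (z (Fin.natAdd s j)).1 ∧
                  Torus.euclidDist (z (Fin.castAdd m i)).1 (z (Fin.natAdd s j)).1 ≤
                    ε + 2 * h * Real.sqrt (2 * configEnergy z)} := by
              ext z; simp only [mem_setOf_eq, mem_iUnion]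
            rw [hW']
            refine MeasurableSet.iUnion fun i => MeasurableSet.iUnion fun j => ?_
            have hc1 : Measurable fun z : Config (s + m) d (UnitAddTorus d) =>
                Torus.euclidDist (z (Fin.castAdd m i)).1 (z (Fin.natAdd s j)).1 := by
              have hc : Continuous fun z : Config (s + m) d (UnitAddTorus d) =>
                  Torus.euclidDist (z (Fin.castAdd m i)).1 (z (Fin.natAdd s j)).1 := by
                have h1 : Continuous fun z : Config (s + m) d (UnitAddTorus d) =>
                    ((z (Fin.castAdd m i)).1, (z (Fin.natAdd s j)).1) := by fun_prop
                simpa only [Function.comp_def] using Torus.continuous_euclidDist.comp h1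
              exact hc.measurable
            have hc2 : Measurable fun z : Config (s + m) d (UnitAddTorus d) =>
                ε + 2 * h * Real.sqrt (2 * configEnergy z) := by
              unfold configEnergy; fun_prop
            exact (measurableSet_le measurable_const hc1).inter (measurableSet_le hc1 hc2)
        exact (hFm.comp (hmp.measurable.comp measurable_id)).aemeasurable.congr
          (Eventually.of_forall fun p => by simp [appendMEquiv_apply])
    _ ≤ ∫⁻ Xs : Config s d (UnitAddTorus d), B'.indicator (1 : Config s d (UnitAddTorus d) → ℝ≥0∞) Xs *
          ENNReal.ofReal (h * A * Real.exp (-(β / 2) * configEnergy Xs)) := by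
        refine lintegral_mono fun Xs => ?_
        simp only [hFapp]
        rw [lintegral_const_mul' _ _ (by
          by_cases hXs : Xs ∈ B' <;> simp [hXs])]
        gcongr
        rw [lintegral_indicator (measurableSet_window Xs h)]
        exact hA h hh Xs
    _ = ENNReal.ofReal (h * A) * ∫⁻ X in B', ENNReal.ofReal (Real.exp (-(β / 2) * configEnergy X)) := by
        rw [← lintegral_indicator hB', ← lintegral_const_mul' _ _ ENNReal.ofReal_ne_top]
        refine lintegral_congr fun Xs => ?_
        by_cases hXs : Xs ∈ B'
        · simp only [indicator_of_mem hXs, Pi.one_apply, one_mul]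
          rw [← ENNReal.ofReal_mul (by positivity), mul_assoc]
        · simp [indicator_of_notMem hXs]

/-- **Data whose tagged part is not good form a null set**: if `S ⊆ D_ε^s` is Lebesgue-null then
so is `{z | tagged z ∈ S}` in `Config (s + m)` (Fubini: it is `S × Config m`). [folklore] -/
theorem volume_setOf_tagged_mem_eq_zero {S : Set (Config s d (UnitAddTorus d))} (hS : MeasurableSet S)
    (hS0 : volume S = 0) :
    volume {z : Config (s + m) d (UnitAddTorus d) | (z ∘ Fin.castAdd m : Config s d (UnitAddTorus d)) ∈ S} = 0 := by
  haveI : SigmaFinite (volume : Measure (UnitAddTorus d × EuclideanSpace ℝ d)) := inferInstance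
  haveI : SigmaFinite (volume : Measure (Config s d (UnitAddTorus d))) := inferInstance
  haveI : SigmaFinite (volume : Measure (Config m d (UnitAddTorus d))) := inferInstance
  have hmp := volume_preserving_appendMEquiv (UnitAddTorus d × EuclideanSpace ℝ d) s m
  have hT : MeasurableSet {z : Config (s + m) d (UnitAddTorus d) |
      (z ∘ Fin.castAdd m : Config s d (UnitAddTorus d)) ∈ S} :=
    (measurable_pi_lambda _ fun i => measurable_pi_apply _) hS
  rw [← hmp.measure_preimage hT.nullMeasurableSet]
  have hpre : (appendMEquiv (UnitAddTorus d × EuclideanSpace ℝ d) s m) ⁻¹'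
      {z : Config (s + m) d (UnitAddTorus d) | (z ∘ Fin.castAdd m : Config s d (UnitAddTorus d)) ∈ S} =
        S ×ˢ (univ : Set (Config m d (UnitAddTorus d))) := by
    ext ⟨Xs, Zm⟩
    simp only [mem_preimage, mem_setOf_eq, appendMEquiv_apply, mem_prod, mem_univ, and_true]
    have : (Fin.append Xs Zm ∘ Fin.castAdd m : Config s d (UnitAddTorus d)) = Xs := by
      funext i; simp
    rw [this]
  rw [hpre, Measure.prod_prod, hS0, zero_mul]

/-- The good data of `ΦN` whose tagged part at time `t` is not good for `Φs` form a
Liouville-null set (`volume_setOf_tagged_mem_eq_zero` for `D_ε^s ∖ good_s`, pulled back by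
`ΦN_t`). [folklore] -/
theorem volume_good_inter_tagged_not_good_eq_zero (Φs : HardSphereFlow (Torus.geometry d) ε s)
    (ΦN : HardSphereFlow (Torus.geometry d) ε (s + m)) (t : ℝ) :
    volume (ΦN.good ∩ {z₀ : Config (s + m) d (UnitAddTorus d) |
      (ΦN.flow t z₀ ∘ Fin.castAdd m : Config s d (UnitAddTorus d)) ∉ Φs.good}) = 0 := by
  -- the bad set at time `0`
  have hS0 : volume {z : Config (s + m) d (UnitAddTorus d) | (z ∘ Fin.castAdd m : Config s d (UnitAddTorus d)) ∈
      hardSphereDomain (Torus.geometry d) s ε \ Φs.good} = 0 :=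
    volume_setOf_tagged_mem_eq_zero ((measurableSet_hardSphereDomain _ Torus.measurable_geometry_sepVec _ _).diff
      Φs.measurableSet_good) Φs.volume_diff_good
  have hL0 : liouville (Torus.geometry d) (s + m) ε {z : Config (s + m) d (UnitAddTorus d) |
      (z ∘ Fin.castAdd m : Config s d (UnitAddTorus d)) ∉ Φs.good} = 0 := by
    rw [liouville_eq, Measure.restrict_apply' (measurableSet_hardSphereDomain _ Torus.measurable_geometry_sepVec _ _)]
    refine measure_mono_null (fun z hz => ?_) hS0
    exact ⟨comp_castAdd_mem_hardSphereDomain hz.2, hz.1⟩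
  have hpre := ΦN.liouville_preimage_null t hL0
  rw [← ΦN.volume_restrict_good_eq, Measure.restrict_apply' ΦN.measurableSet_good] at hpre
  rw [inter_comm]
  exact hpre

/-! ## §4. The integrated Lipschitz estimate -/

/-- Pointwise control of the change of the indicator between `t₁ ≤ t₂` for a good `z₀`:
either the tagged part at `t₁` is not good, or the orbit has a tagged–untagged contact in
`(t₁, t₂]`, or the indicator does not change. [folklore] -/
theorem abs_indicator_sub_le (Φs : HardSphereFlow (Torus.geometry d) ε s)
    (ΦN : HardSphereFlow (Torus.geometry d) ε (s + m)) {B : Set (Config s d (UnitAddTorus d))}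
    (hBg : B ⊆ Φs.good) {z₀ : Config (s + m) d (UnitAddTorus d)} (hz₀ : z₀ ∈ ΦN.good)
    {t₁ t₂ : ℝ} (h12 : t₁ ≤ t₂) :
    |(Φs.flow t₂ '' B).indicator (1 : Config s d (UnitAddTorus d) → ℝ) (ΦN.flow t₂ z₀ ∘ Fin.castAdd m) -
        (Φs.flow t₁ '' B).indicator (1 : Config s d (UnitAddTorus d) → ℝ) (ΦN.flow t₁ z₀ ∘ Fin.castAdd m)| ≤
      ({z₀ : Config (s + m) d (UnitAddTorus d) |
          (ΦN.flow t₁ z₀ ∘ Fin.castAdd m : Config s d (UnitAddTorus d)) ∉ Φs.good}.indicator 1 z₀ +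
        {z₀ : Config (s + m) d (UnitAddTorus d) | ∃ τ ∈ Ioc t₁ t₂, ∃ I J : Fin (s + m), I ≠ J ∧
          ΦN.flow τ z₀ ∈ contactSet (Torus.geometry d) (s + m) ε I J ∧ ¬ ((I : ℕ) < s ↔ (J : ℕ) < s)}.indicator 1 z₀) *
      ((Φs.flow t₂ '' B).indicator (1 : Config s d (UnitAddTorus d) → ℝ) (ΦN.flow t₂ z₀ ∘ Fin.castAdd m) +
        (Φs.flow t₁ '' B).indicator (1 : Config s d (UnitAddTorus d) → ℝ) (ΦN.flow t₁ z₀ ∘ Fin.castAdd m)) := by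
  have h01 : ∀ (t : ℝ), (Φs.flow t '' B).indicator (1 : Config s d (UnitAddTorus d) → ℝ)
      (ΦN.flow t z₀ ∘ Fin.castAdd m) = 0 ∨
      (Φs.flow t '' B).indicator (1 : Config s d (UnitAddTorus d) → ℝ) (ΦN.flow t z₀ ∘ Fin.castAdd m) = 1 := by
    intro t
    by_cases h : (ΦN.flow t z₀ ∘ Fin.castAdd m : Config s d (UnitAddTorus d)) ∈ Φs.flow t '' B
    · exact Or.inr (by simp [h])
    · exact Or.inl (by simp [h])
  have hg0 : 0 ≤ ({z₀ : Config (s + m) d (UnitAddTorus d) |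
      (ΦN.flow t₁ z₀ ∘ Fin.castAdd m : Config s d (UnitAddTorus d)) ∉ Φs.good}.indicator
        (1 : Config (s + m) d (UnitAddTorus d) → ℝ) z₀) := indicator_nonneg (fun _ _ => zero_le_one) _
  have hc0 : 0 ≤ ({z₀ : Config (s + m) d (UnitAddTorus d) | ∃ τ ∈ Ioc t₁ t₂, ∃ I J : Fin (s + m), I ≠ J ∧
      ΦN.flow τ z₀ ∈ contactSet (Torus.geometry d) (s + m) ε I J ∧ ¬ ((I : ℕ) < s ↔ (J : ℕ) < s)}.indicator
        (1 : Config (s + m) d (UnitAddTorus d) → ℝ) z₀) := indicator_nonneg (fun _ _ => zero_le_one) _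
  -- either the indicator does not change, or one of the two exceptional indicators is `1`
  have halt : (Φs.flow t₂ '' B).indicator (1 : Config s d (UnitAddTorus d) → ℝ) (ΦN.flow t₂ z₀ ∘ Fin.castAdd m) =
        (Φs.flow t₁ '' B).indicator (1 : Config s d (UnitAddTorus d) → ℝ) (ΦN.flow t₁ z₀ ∘ Fin.castAdd m) ∨
      1 ≤ {z₀ : Config (s + m) d (UnitAddTorus d) |
          (ΦN.flow t₁ z₀ ∘ Fin.castAdd m : Config s d (UnitAddTorus d)) ∉ Φs.good}.indicator
            (1 : Config (s + m) d (UnitAddTorus d) → ℝ) z₀ +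
        {z₀ : Config (s + m) d (UnitAddTorus d) | ∃ τ ∈ Ioc t₁ t₂, ∃ I J : Fin (s + m), I ≠ J ∧
          ΦN.flow τ z₀ ∈ contactSet (Torus.geometry d) (s + m) ε I J ∧ ¬ ((I : ℕ) < s ↔ (J : ℕ) < s)}.indicator
            (1 : Config (s + m) d (UnitAddTorus d) → ℝ) z₀ := by
    by_cases hgood : (ΦN.flow t₁ z₀ ∘ Fin.castAdd m : Config s d (UnitAddTorus d)) ∈ Φs.good
    · by_cases hcont : ∃ τ ∈ Ioc t₁ t₂, ∃ I J : Fin (s + m), I ≠ J ∧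
          ΦN.flow τ z₀ ∈ contactSet (Torus.geometry d) (s + m) ε I J ∧ ¬ ((I : ℕ) < s ↔ (J : ℕ) < s)
      · refine Or.inr ?_
        rw [indicator_of_mem (show z₀ ∈ {z₀ : Config (s + m) d (UnitAddTorus d) | ∃ τ ∈ Ioc t₁ t₂,
          ∃ I J : Fin (s + m), I ≠ J ∧ ΦN.flow τ z₀ ∈ contactSet (Torus.geometry d) (s + m) ε I J ∧
            ¬ ((I : ℕ) < s ↔ (J : ℕ) < s)} from hcont), Pi.one_apply]
        linarith [hg0]
      · refine Or.inl ?_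
        push Not at hcont
        exact indicator_image_tagged_eq Φs ΦN hBg hz₀ h12 hgood (fun τ hτ I J hIJ hc => hcont τ hτ I J hIJ hc)
    · refine Or.inr ?_
      rw [indicator_of_mem (show z₀ ∈ {z₀ : Config (s + m) d (UnitAddTorus d) |
        (ΦN.flow t₁ z₀ ∘ Fin.castAdd m : Config s d (UnitAddTorus d)) ∉ Φs.good} from hgood), Pi.one_apply]
      linarith [hc0]
  -- elementary arithmetic with values in `{0, 1}`
  have hb := h01 t₂
  have ha := h01 t₁
  generalize (Φs.flow t₂ '' B).indicator (1 : Config s d (UnitAddTorus d) → ℝ) (ΦN.flow t₂ z₀ ∘ Fin.castAdd m) = b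
    at hb halt ⊢
  generalize (Φs.flow t₁ '' B).indicator (1 : Config s d (UnitAddTorus d) → ℝ) (ΦN.flow t₁ z₀ ∘ Fin.castAdd m) = a
    at ha halt ⊢
  generalize {z₀ : Config (s + m) d (UnitAddTorus d) |
      (ΦN.flow t₁ z₀ ∘ Fin.castAdd m : Config s d (UnitAddTorus d)) ∉ Φs.good}.indicator
        (1 : Config (s + m) d (UnitAddTorus d) → ℝ) z₀ = g at hg0 halt ⊢
  generalize {z₀ : Config (s + m) d (UnitAddTorus d) | ∃ τ ∈ Ioc t₁ t₂, ∃ I J : Fin (s + m), I ≠ J ∧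
      ΦN.flow τ z₀ ∈ contactSet (Torus.geometry d) (s + m) ε I J ∧ ¬ ((I : ℕ) < s ↔ (J : ℕ) < s)}.indicator
        (1 : Config (s + m) d (UnitAddTorus d) → ℝ) z₀ = c at hc0 halt ⊢
  rcases halt with hab | hge
  · rw [hab, sub_self, abs_zero]
    refine mul_nonneg (add_nonneg hg0 hc0) ?_
    rcases ha with rfl | rfl <;> norm_num
  · rcases ha with rfl | rfl <;> rcases hb with rfl | rfl <;> norm_num <;> nlinarith

/-- **One end of the window.** For good `z₀` with a tagged–untagged contact in `(t₁, t₂]`,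
the configuration `ΦN_{t_k} z₀` (`t_k ∈ [t₁, t₂]`) lies in the collision window set of duration
`t₂ - t₁` (`mem_window_of_contact`); with `|W| ≤ C_W e^{-βE}` and energy conservation,
`|W(z₀)| 1_{contact}(z₀) 1_{B'}(tagged ΦN_{t_k} z₀) ≤ C_W (1_{B'}(tagged ·) 1_{window} e^{-βE})(ΦN_{t_k} z₀)`. [folklore] -/
theorem contact_term_le (ΦN : HardSphereFlow (Torus.geometry d) ε (s + m))
    {W : Config (s + m) d (UnitAddTorus d) → ℝ}
    (hCW : 0 ≤ CW) (hWb : ∀ z, |W z| ≤ CW * Real.exp (-β * configEnergy z))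
    (B' : Set (Config s d (UnitAddTorus d))) {t₁ t₂ tk : ℝ} (htk : tk ∈ Icc t₁ t₂)
    {z₀ : Config (s + m) d (UnitAddTorus d)} (hz₀ : z₀ ∈ ΦN.good) :
    |W z₀| *
        ({z₀ : Config (s + m) d (UnitAddTorus d) | ∃ τ ∈ Ioc t₁ t₂, ∃ I J : Fin (s + m), I ≠ J ∧
          ΦN.flow τ z₀ ∈ contactSet (Torus.geometry d) (s + m) ε I J ∧ ¬ ((I : ℕ) < s ↔ (J : ℕ) < s)}.indicator
            (1 : Config (s + m) d (UnitAddTorus d) → ℝ) z₀ *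
          B'.indicator (1 : Config s d (UnitAddTorus d) → ℝ) (ΦN.flow tk z₀ ∘ Fin.castAdd m)) ≤
      CW * (B'.indicator (1 : Config s d (UnitAddTorus d) → ℝ) (ΦN.flow tk z₀ ∘ Fin.castAdd m) *
        {z : Config (s + m) d (UnitAddTorus d) | ∃ (i : Fin s) (j : Fin m),
          ε ≤ Torus.euclidDist (z (Fin.castAdd m i)).1 (z (Fin.natAdd s j)).1 ∧
            Torus.euclidDist (z (Fin.castAdd m i)).1 (z (Fin.natAdd s j)).1 ≤
              ε + 2 * (t₂ - t₁) * Real.sqrt (2 * configEnergy z)}.indicator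
          (fun z => Real.exp (-β * configEnergy z)) (ΦN.flow tk z₀)) := by
  have hind1 : 0 ≤ B'.indicator (1 : Config s d (UnitAddTorus d) → ℝ) (ΦN.flow tk z₀ ∘ Fin.castAdd m) :=
    indicator_nonneg (fun _ _ => zero_le_one) _
  by_cases hcont : z₀ ∈ {z₀ : Config (s + m) d (UnitAddTorus d) | ∃ τ ∈ Ioc t₁ t₂,
      ∃ I J : Fin (s + m), I ≠ J ∧ ΦN.flow τ z₀ ∈ contactSet (Torus.geometry d) (s + m) ε I J ∧
        ¬ ((I : ℕ) < s ↔ (J : ℕ) < s)}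
  · rw [indicator_of_mem hcont, Pi.one_apply, one_mul]
    obtain ⟨τ, hτ, I, J, hIJ, hc, htu⟩ := hcont
    have hwin := mem_window_of_contact ΦN hz₀ ⟨hτ.1.le, hτ.2⟩ hIJ hc htu htk
    rw [indicator_of_mem (show ΦN.flow tk z₀ ∈ {z : Config (s + m) d (UnitAddTorus d) | ∃ (i : Fin s) (j : Fin m),
        ε ≤ Torus.euclidDist (z (Fin.castAdd m i)).1 (z (Fin.natAdd s j)).1 ∧
          Torus.euclidDist (z (Fin.castAdd m i)).1 (z (Fin.natAdd s j)).1 ≤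
            ε + 2 * (t₂ - t₁) * Real.sqrt (2 * configEnergy z)} from hwin)]
    have hWz : |W z₀| ≤ CW * Real.exp (-β * configEnergy (ΦN.flow tk z₀)) := by
      rw [ΦN.configEnergy_flow hz₀ tk]; exact hWb z₀
    calc |W z₀| * B'.indicator 1 (ΦN.flow tk z₀ ∘ Fin.castAdd m)
        ≤ (CW * Real.exp (-β * configEnergy (ΦN.flow tk z₀))) * B'.indicator 1 (ΦN.flow tk z₀ ∘ Fin.castAdd m) := by
          gcongr
      _ = _ := by ring
  · rw [indicator_of_notMem hcont, zero_mul, mul_zero]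
    refine mul_nonneg hCW (mul_nonneg hind1 ?_)
    exact indicator_nonneg (fun _ _ => (Real.exp_pos _).le) _

/-- The Gaussian `Z ↦ e^{-b E(Z)}`, `b > 0`, is integrable on the phase space of the torus
(positions have total mass one, velocities are Gaussian). [folklore] -/
theorem integrable_exp_neg_mul_configEnergy {n : ℕ} {b : ℝ} (hb : 0 < b) :
    Integrable (fun Z : Config n d (UnitAddTorus d) => Real.exp (-b * configEnergy Z)) := by
  have huniv : volume (univ : Set (UnitAddTorus d)) = 1 := by
    rw [volume_pi, Measure.pi_univ]; simp
  haveI : IsProbabilityMeasure (volume : Measure (UnitAddTorus d)) := ⟨huniv⟩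
  haveI : SigmaFinite (volume : Measure (UnitAddTorus d × EuclideanSpace ℝ d)) := inferInstance
  have h1 : ∀ k : Fin n, Integrable (fun p : UnitAddTorus d × EuclideanSpace ℝ d =>
      Real.exp (-(b / 2) * ‖p.2‖ ^ 2)) := by
    intro k
    have hg := Literature.Analysis.UnboundedOperators.integrable_gaussian_of_pos
      (E := EuclideanSpace ℝ d) (b := b / 2) (by positivity)
    have := (integrable_const (μ := (volume : Measure (UnitAddTorus d))) (1 : ℝ)).mul_prod hg
    rw [← Measure.volume_eq_prod] at this
    simpa using this
  have h2 := Integrable.fintype_prod (ι := Fin n)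
    (μ := fun _ => (volume : Measure (UnitAddTorus d × EuclideanSpace ℝ d)))
    (f := fun _ p => Real.exp (-(b / 2) * ‖p.2‖ ^ 2)) h1
  rw [← volume_pi] at h2
  refine h2.congr (Eventually.of_forall fun Z => ?_)
  simp only
  rw [← Real.exp_sum]
  congr 1
  unfold configEnergy
  rw [Finset.mul_sum, Finset.mul_sum]
  refine Finset.sum_congr rfl fun k _ => ?_
  ring

/-- Liouville substitution for set integrals over images: `∫_{Φ_t(B)} g = ∫_B g ∘ Φ_t` for
`B ⊆ good`. [folklore] -/
theorem _root_.Literature.Analysis.FluidPDE.HardSphereFlow.setIntegral_image_flow_eq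
    {X : Type*} [MeasureSpace X] [TopologicalSpace X] {G : Geometry d X} {n : ℕ}
    (Φ : HardSphereFlow G ε n) (t : ℝ) {B : Set (Config n d X)} (hB : MeasurableSet B)
    (hBg : B ⊆ Φ.good) {g : Config n d X → ℝ} (hg : Measurable g) :
    ∫ z in Φ.flow t '' B, g z = ∫ z in B, g (Φ.flow t z) := by
  have hBt : MeasurableSet (Φ.flow t '' B) := Φ.measurableSet_image_flow t hB hBg
  have hBtg : Φ.flow t '' B ⊆ Φ.good := by
    rintro _ ⟨Y, hY, rfl⟩; exact Φ.mapsTo_good t (hBg hY)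
  calc ∫ z in Φ.flow t '' B, g z = ∫ z in Φ.good, (Φ.flow t '' B).indicator g z := by
        rw [setIntegral_indicator hBt, inter_eq_right.2 hBtg]
    _ = ∫ z in Φ.good, (Φ.flow t '' B).indicator g (Φ.flow t z) :=
        (Φ.setIntegral_comp_flow t (hg.indicator hBt)).symm
    _ = ∫ z in Φ.good, B.indicator (fun z => g (Φ.flow t z)) z := by
        refine setIntegral_congr_fun Φ.measurableSet_good fun Y hY => ?_
        exact Φ.indicator_image_flow t hBg g hY
    _ = ∫ z in B, g (Φ.flow t z) := by
        rw [setIntegral_indicator hB, inter_eq_right.2 hBg]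

/-- **The integrated Lipschitz estimate for the marginal along the tagged flow** (torus,
`0 < ε ≤ 1/2`). Let `|W| ≤ C_W e^{-βE}` be measurable and integrable, and
`u(t, Y) = f_N^{(s)}(t)(Φs_t Y)` with `f_N(t) = 1_{good_N} W ∘ ΦN_{-t}`. There is `L ≥ 0`
(`= 2 C_W A`, `A` from `lintegral_tagged_window_le`) such that for all `t₁ ≤ t₂` and all
measurable `B ⊆ good_s`,
`|∫_B (u(t₂) - u(t₁)) dY| ≤ L (t₂ - t₁) ∫_B e^{-βE(Y)/2} dY`.
Proof: by the weak form both integrals are `∫_{good_N} W 1_{Φs_{t_k}B}(tagged ΦN_{t_k} ·)`;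
the indicators differ only on the data with a tagged–untagged contact in `(t₁, t₂]`
(`abs_indicator_sub_le`) — up to the null set of data with non-good tagged part — and those
lie at either end of the window in the collision window set (`contact_term_le`), whose
`B`-localised Gaussian volume after a Liouville substitution is `≤ A (t₂ - t₁) ∫_B e^{-βE/2}`
(`lintegral_tagged_window_le`, Liouville and energy conservation for `Φs`). This is the
integrated, inequality form of CIP 1994 Thm 4.3.1 / App. 4.B Step 2 and Spohn 2006 Prop. 1. [cite: CIP1994, App. 4.B] -/
theorem abs_setIntegral_marginal_flow_sub_le (hε : 0 < ε) (hε2 : ε ≤ 1 / 2) (hβ : 0 < β)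
    (Φs : HardSphereFlow (Torus.geometry d) ε s) (ΦN : HardSphereFlow (Torus.geometry d) ε (s + m))
    {W : Config (s + m) d (UnitAddTorus d) → ℝ} (hW : Measurable W) (hWi : Integrable W)
    (hCW : 0 ≤ CW) (hWb : ∀ z, |W z| ≤ CW * Real.exp (-β * configEnergy z)) :
    ∃ L : ℝ, 0 ≤ L ∧ ∀ t₁ t₂ : ℝ, t₁ ≤ t₂ → ∀ B : Set (Config s d (UnitAddTorus d)),
      MeasurableSet B → B ⊆ Φs.good →
        |∫ Y in B, (nthMarginal (s + m) s (ΦN.good.indicator fun z => W (ΦN.flow (-t₂) z)) (Φs.flow t₂ Y) -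
            nthMarginal (s + m) s (ΦN.good.indicator fun z => W (ΦN.flow (-t₁) z)) (Φs.flow t₁ Y))| ≤
          L * (t₂ - t₁) * ∫ Y in B, Real.exp (-(β / 2) * configEnergy Y) := by
  classical
  obtain ⟨A, hA0, hA⟩ := lintegral_tagged_window_le (d := d) hε hε2 hβ s m
  refine ⟨2 * CW * A, by positivity, fun t₁ t₂ h12 B hB hBg => ?_⟩
  have hh : 0 ≤ t₂ - t₁ := sub_nonneg.2 h12
  -- opaque names: the indicator read along the flow, the window weight, the contact event
  obtain ⟨ind, hind⟩ : ∃ ind : ℝ → Config (s + m) d (UnitAddTorus d) → ℝ, ind = fun t z₀ =>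
      (Φs.flow t '' B).indicator (1 : Config s d (UnitAddTorus d) → ℝ) (ΦN.flow t z₀ ∘ Fin.castAdd m) :=
    ⟨_, rfl⟩
  obtain ⟨Gw, hGw⟩ : ∃ Gw : ℝ → Config (s + m) d (UnitAddTorus d) → ℝ, Gw = fun t z =>
      (Φs.flow t '' B).indicator (1 : Config s d (UnitAddTorus d) → ℝ) (z ∘ Fin.castAdd m) *
        {z : Config (s + m) d (UnitAddTorus d) | ∃ (i : Fin s) (j : Fin m),
          ε ≤ Torus.euclidDist (z (Fin.castAdd m i)).1 (z (Fin.natAdd s j)).1 ∧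
            Torus.euclidDist (z (Fin.castAdd m i)).1 (z (Fin.natAdd s j)).1 ≤
              ε + 2 * (t₂ - t₁) * Real.sqrt (2 * configEnergy z)}.indicator
          (fun z => Real.exp (-β * configEnergy z)) z := ⟨_, rfl⟩
  obtain ⟨NG, hNG⟩ : ∃ NG : Set (Config (s + m) d (UnitAddTorus d)), NG = {z₀ |
      (ΦN.flow t₁ z₀ ∘ Fin.castAdd m : Config s d (UnitAddTorus d)) ∉ Φs.good} := ⟨_, rfl⟩
  -- elementary properties
  have hBt : ∀ t, MeasurableSet (Φs.flow t '' B) := fun t => Φs.measurableSet_image_flow t hB hBg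
  have hind01 : ∀ t z₀, 0 ≤ ind t z₀ ∧ ind t z₀ ≤ 1 := fun t z₀ => by
    rw [hind]
    by_cases h : (ΦN.flow t z₀ ∘ Fin.castAdd m : Config s d (UnitAddTorus d)) ∈ Φs.flow t '' B <;> simp [h]
  have hindm : ∀ t, Measurable (ind t) := fun t => by
    rw [hind]
    exact (measurable_one.indicator (hBt t)).comp
      ((measurable_pi_lambda _ fun i => (measurable_pi_apply _).comp (ΦN.measurable_flow t)))
  have hNGm : MeasurableSet NG := by
    rw [hNG]
    exact ((measurable_pi_lambda _ fun i => (measurable_pi_apply _).comp (ΦN.measurable_flow t₁))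
      Φs.measurableSet_good).compl
  have hWinm : MeasurableSet {z : Config (s + m) d (UnitAddTorus d) | ∃ (i : Fin s) (j : Fin m),
      ε ≤ Torus.euclidDist (z (Fin.castAdd m i)).1 (z (Fin.natAdd s j)).1 ∧
        Torus.euclidDist (z (Fin.castAdd m i)).1 (z (Fin.natAdd s j)).1 ≤
          ε + 2 * (t₂ - t₁) * Real.sqrt (2 * configEnergy z)} := by
    have hW' : {z : Config (s + m) d (UnitAddTorus d) | ∃ (i : Fin s) (j : Fin m),
        ε ≤ Torus.euclidDist (z (Fin.castAdd m i)).1 (z (Fin.natAdd s j)).1 ∧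
          Torus.euclidDist (z (Fin.castAdd m i)).1 (z (Fin.natAdd s j)).1 ≤
            ε + 2 * (t₂ - t₁) * Real.sqrt (2 * configEnergy z)} =
        ⋃ (i : Fin s) (j : Fin m), {z | ε ≤ Torus.euclidDist (z (Fin.castAdd m i)).1 (z (Fin.natAdd s j)).1 ∧
          Torus.euclidDist (z (Fin.castAdd m i)).1 (z (Fin.natAdd s j)).1 ≤
            ε + 2 * (t₂ - t₁) * Real.sqrt (2 * configEnergy z)} := by
      ext z; simp only [mem_setOf_eq, mem_iUnion]
    rw [hW']
    refine MeasurableSet.iUnion fun i => MeasurableSet.iUnion fun j => ?_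
    have hc1 : Measurable fun z : Config (s + m) d (UnitAddTorus d) =>
        Torus.euclidDist (z (Fin.castAdd m i)).1 (z (Fin.natAdd s j)).1 := by
      have hc : Continuous fun z : Config (s + m) d (UnitAddTorus d) =>
          Torus.euclidDist (z (Fin.castAdd m i)).1 (z (Fin.natAdd s j)).1 := by
        have h1 : Continuous fun z : Config (s + m) d (UnitAddTorus d) =>
            ((z (Fin.castAdd m i)).1, (z (Fin.natAdd s j)).1) := by fun_prop
        simpa only [Function.comp_def] using Torus.continuous_euclidDist.comp h1
      exact hc.measurable
    have hc2 : Measurable fun z : Config (s + m) d (UnitAddTorus d) =>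
        ε + 2 * (t₂ - t₁) * Real.sqrt (2 * configEnergy z) := by
      unfold configEnergy; fun_prop
    exact (measurableSet_le measurable_const hc1).inter (measurableSet_le hc1 hc2)
  have hEm : Measurable fun z : Config (s + m) d (UnitAddTorus d) => Real.exp (-β * configEnergy z) := by
    unfold configEnergy; fun_prop
  have hGwm : ∀ t, Measurable (Gw t) := fun t => by
    rw [hGw]
    exact ((measurable_one.indicator (hBt t)).comp (measurable_pi_lambda _ fun i => measurable_pi_apply _)).mul
      (hEm.indicator hWinm)
  have hGw0 : ∀ t z, 0 ≤ Gw t z ∧ Gw t z ≤ Real.exp (-β * configEnergy z) := by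
    intro t z
    rw [hGw]
    have h1 : 0 ≤ (Φs.flow t '' B).indicator (1 : Config s d (UnitAddTorus d) → ℝ) (z ∘ Fin.castAdd m) ∧
        (Φs.flow t '' B).indicator (1 : Config s d (UnitAddTorus d) → ℝ) (z ∘ Fin.castAdd m) ≤ 1 := by
      by_cases h : (z ∘ Fin.castAdd m : Config s d (UnitAddTorus d)) ∈ Φs.flow t '' B <;> simp [h]
    have h2 : 0 ≤ {z : Config (s + m) d (UnitAddTorus d) | ∃ (i : Fin s) (j : Fin m),
          ε ≤ Torus.euclidDist (z (Fin.castAdd m i)).1 (z (Fin.natAdd s j)).1 ∧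
            Torus.euclidDist (z (Fin.castAdd m i)).1 (z (Fin.natAdd s j)).1 ≤
              ε + 2 * (t₂ - t₁) * Real.sqrt (2 * configEnergy z)}.indicator
          (fun z => Real.exp (-β * configEnergy z)) z ∧
        {z : Config (s + m) d (UnitAddTorus d) | ∃ (i : Fin s) (j : Fin m),
          ε ≤ Torus.euclidDist (z (Fin.castAdd m i)).1 (z (Fin.natAdd s j)).1 ∧
            Torus.euclidDist (z (Fin.castAdd m i)).1 (z (Fin.natAdd s j)).1 ≤
              ε + 2 * (t₂ - t₁) * Real.sqrt (2 * configEnergy z)}.indicator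
          (fun z => Real.exp (-β * configEnergy z)) z ≤ Real.exp (-β * configEnergy z) := by
      by_cases h : z ∈ {z : Config (s + m) d (UnitAddTorus d) | ∃ (i : Fin s) (j : Fin m),
          ε ≤ Torus.euclidDist (z (Fin.castAdd m i)).1 (z (Fin.natAdd s j)).1 ∧
            Torus.euclidDist (z (Fin.castAdd m i)).1 (z (Fin.natAdd s j)).1 ≤
              ε + 2 * (t₂ - t₁) * Real.sqrt (2 * configEnergy z)}
      · simp only [indicator_of_mem h, le_refl, and_true]; exact (Real.exp_pos _).le
      · simp only [indicator_of_notMem h, le_refl, true_and]; exact (Real.exp_pos _).le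
    constructor
    · exact mul_nonneg h1.1 h2.1
    · calc _ ≤ 1 * Real.exp (-β * configEnergy z) := mul_le_mul h1.2 h2.2 h2.1 zero_le_one
        _ = _ := one_mul _
  have hEi : Integrable (fun z : Config (s + m) d (UnitAddTorus d) => Real.exp (-β * configEnergy z)) :=
    integrable_exp_neg_mul_configEnergy hβ
  have hGwi : ∀ t, Integrable (Gw t) := fun t =>
    Integrable.mono' hEi (hGwm t).aestronglyMeasurable (Eventually.of_forall fun z => by
      rw [Real.norm_eq_abs, abs_of_nonneg (hGw0 t z).1]; exact (hGw0 t z).2)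
  -- integrability of `W · ind t` on the good set
  have hWind : ∀ t, Integrable (fun z₀ => ind t z₀ * W z₀) (volume.restrict ΦN.good) := fun t => by
    refine Integrable.mono' (hWi.abs.mono_measure Measure.restrict_le_self)
      ((hindm t).mul hW).aestronglyMeasurable (Eventually.of_forall fun z₀ => ?_)
    rw [Real.norm_eq_abs, abs_mul, abs_of_nonneg (hind01 t z₀).1]
    calc ind t z₀ * |W z₀| ≤ 1 * |W z₀| := by gcongr; exact (hind01 t z₀).2
      _ = |W z₀| := one_mul _
  -- Step 1: weak form at both times
  have hwf : ∀ t, ∫ Y in B, nthMarginal (s + m) s (ΦN.good.indicator fun z => W (ΦN.flow (-t) z)) (Φs.flow t Y) =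
      ∫ z₀ in ΦN.good, ind t z₀ * W z₀ := fun t => by
    rw [setIntegral_marginal_flow_eq Φs ΦN hW hWi t hB hBg, hind]
  have hint : ∀ t, Integrable (fun Y => nthMarginal (s + m) s
      (ΦN.good.indicator fun z => W (ΦN.flow (-t) z)) (Φs.flow t Y)) (volume.restrict B) := by
    intro t
    have hρi := integrable_indicator_transport ΦN hW hWi t
    have hfsi : Integrable (nthMarginal (s + m) s (ΦN.good.indicator fun z => W (ΦN.flow (-t) z))) :=
      integrable_nthMarginal (Nat.le_add_right s m) hρi
    have hfsm : Measurable (nthMarginal (s + m) s (ΦN.good.indicator fun z => W (ΦN.flow (-t) z))) :=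
      measurable_nthMarginal _ _ (measurable_indicator_transport ΦN hW t)
    have h1 := ((Φs.measurePreserving_restrict_good t).integrable_comp hfsm.aestronglyMeasurable).2
      (hfsi.mono_measure Measure.restrict_le_self)
    exact h1.mono_measure (Measure.restrict_mono hBg le_rfl)
  rw [integral_sub (hint t₂) (hint t₁), hwf t₂, hwf t₁, ← integral_sub (hWind t₂) (hWind t₁)]
  -- Step 2: pointwise bound of the difference on the good set by a measurable function
  have hpt : ∀ z₀ ∈ ΦN.good, |ind t₂ z₀ * W z₀ - ind t₁ z₀ * W z₀| ≤
      2 * (|W z₀| * NG.indicator 1 z₀) + (CW * Gw t₂ (ΦN.flow t₂ z₀) + CW * Gw t₁ (ΦN.flow t₁ z₀)) := by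
    intro z₀ hz₀
    have key := abs_indicator_sub_le Φs ΦN hBg hz₀ h12 (B := B)
    have h2 : ind t₂ z₀ = (Φs.flow t₂ '' B).indicator (1 : Config s d (UnitAddTorus d) → ℝ)
        (ΦN.flow t₂ z₀ ∘ Fin.castAdd m) := by rw [hind]
    have h1 : ind t₁ z₀ = (Φs.flow t₁ '' B).indicator (1 : Config s d (UnitAddTorus d) → ℝ)
        (ΦN.flow t₁ z₀ ∘ Fin.castAdd m) := by rw [hind]
    rw [← h2, ← h1, ← hNG] at key
    have hc2 := contact_term_le ΦN hCW hWb (Φs.flow t₂ '' B) (t₁ := t₁) (t₂ := t₂) (tk := t₂)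
      ⟨h12, le_rfl⟩ hz₀ (β := β) (m := m)
    have hc1 := contact_term_le ΦN hCW hWb (Φs.flow t₁ '' B) (t₁ := t₁) (t₂ := t₂) (tk := t₁)
      ⟨le_rfl, h12⟩ hz₀ (β := β) (m := m)
    rw [← h2] at hc2
    rw [← h1] at hc1
    have hG2 : Gw t₂ (ΦN.flow t₂ z₀) = ind t₂ z₀ *
        {z : Config (s + m) d (UnitAddTorus d) | ∃ (i : Fin s) (j : Fin m),
          ε ≤ Torus.euclidDist (z (Fin.castAdd m i)).1 (z (Fin.natAdd s j)).1 ∧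
            Torus.euclidDist (z (Fin.castAdd m i)).1 (z (Fin.natAdd s j)).1 ≤
              ε + 2 * (t₂ - t₁) * Real.sqrt (2 * configEnergy z)}.indicator
          (fun z => Real.exp (-β * configEnergy z)) (ΦN.flow t₂ z₀) := by rw [hGw, h2]
    have hG1 : Gw t₁ (ΦN.flow t₁ z₀) = ind t₁ z₀ *
        {z : Config (s + m) d (UnitAddTorus d) | ∃ (i : Fin s) (j : Fin m),
          ε ≤ Torus.euclidDist (z (Fin.castAdd m i)).1 (z (Fin.natAdd s j)).1 ∧
            Torus.euclidDist (z (Fin.castAdd m i)).1 (z (Fin.natAdd s j)).1 ≤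
              ε + 2 * (t₂ - t₁) * Real.sqrt (2 * configEnergy z)}.indicator
          (fun z => Real.exp (-β * configEnergy z)) (ΦN.flow t₁ z₀) := by rw [hGw, h1]
    rw [← hG2, ← mul_assoc] at hc2
    rw [← hG1, ← mul_assoc] at hc1
    -- abbreviate the two scalar indicators
    have hNG0 : 0 ≤ NG.indicator (1 : Config (s + m) d (UnitAddTorus d) → ℝ) z₀ :=
      indicator_nonneg (fun _ _ => zero_le_one) _
    have hC0 : 0 ≤ ({z₀ : Config (s + m) d (UnitAddTorus d) | ∃ τ ∈ Ioc t₁ t₂, ∃ I J : Fin (s + m), I ≠ J ∧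
        ΦN.flow τ z₀ ∈ contactSet (Torus.geometry d) (s + m) ε I J ∧ ¬ ((I : ℕ) < s ↔ (J : ℕ) < s)}.indicator
          (1 : Config (s + m) d (UnitAddTorus d) → ℝ) z₀) := indicator_nonneg (fun _ _ => zero_le_one) _
    have hi1 := hind01 t₁ z₀
    have hi2 := hind01 t₂ z₀
    have hW0 : 0 ≤ |W z₀| := abs_nonneg _
    rw [← sub_mul, abs_mul]
    calc |ind t₂ z₀ - ind t₁ z₀| * |W z₀|
        ≤ ((NG.indicator 1 z₀ +
            {z₀ : Config (s + m) d (UnitAddTorus d) | ∃ τ ∈ Ioc t₁ t₂, ∃ I J : Fin (s + m), I ≠ J ∧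
              ΦN.flow τ z₀ ∈ contactSet (Torus.geometry d) (s + m) ε I J ∧ ¬ ((I : ℕ) < s ↔ (J : ℕ) < s)}.indicator 1 z₀) *
            (ind t₂ z₀ + ind t₁ z₀)) * |W z₀| := by gcongr
      _ = |W z₀| * NG.indicator 1 z₀ * (ind t₂ z₀ + ind t₁ z₀) +
          (|W z₀| * {z₀ : Config (s + m) d (UnitAddTorus d) | ∃ τ ∈ Ioc t₁ t₂, ∃ I J : Fin (s + m), I ≠ J ∧
              ΦN.flow τ z₀ ∈ contactSet (Torus.geometry d) (s + m) ε I J ∧ ¬ ((I : ℕ) < s ↔ (J : ℕ) < s)}.indicator 1 z₀ *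
              ind t₂ z₀ +
            |W z₀| * {z₀ : Config (s + m) d (UnitAddTorus d) | ∃ τ ∈ Ioc t₁ t₂, ∃ I J : Fin (s + m), I ≠ J ∧
              ΦN.flow τ z₀ ∈ contactSet (Torus.geometry d) (s + m) ε I J ∧ ¬ ((I : ℕ) < s ↔ (J : ℕ) < s)}.indicator 1 z₀ *
              ind t₁ z₀) := by ring
      _ ≤ 2 * (|W z₀| * NG.indicator 1 z₀) + (CW * Gw t₂ (ΦN.flow t₂ z₀) + CW * Gw t₁ (ΦN.flow t₁ z₀)) :=
          add_le_add (by nlinarith [mul_nonneg hW0 hNG0, hi1.2, hi2.2]) (add_le_add hc2 hc1)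
  -- Step 3: integrate
  have hI1 : Integrable (fun z₀ => 2 * (|W z₀| * NG.indicator 1 z₀)) (volume.restrict ΦN.good) := by
    refine Integrable.const_mul ?_ _
    refine Integrable.mono' (hWi.abs.mono_measure Measure.restrict_le_self)
      (hW.abs.mul (measurable_one.indicator hNGm)).aestronglyMeasurable (Eventually.of_forall fun z₀ => ?_)
    have h1 : 0 ≤ NG.indicator (1 : Config (s + m) d (UnitAddTorus d) → ℝ) z₀ ∧
        NG.indicator (1 : Config (s + m) d (UnitAddTorus d) → ℝ) z₀ ≤ 1 := by
      by_cases h : z₀ ∈ NG <;> simp [h]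
    rw [Real.norm_eq_abs, abs_mul, abs_abs, abs_of_nonneg h1.1]
    calc |W z₀| * NG.indicator 1 z₀ ≤ |W z₀| * 1 := by gcongr; exact h1.2
      _ = |W z₀| := mul_one _
  have hI2 : Integrable (fun z₀ => CW * Gw t₂ (ΦN.flow t₂ z₀)) (volume.restrict ΦN.good) :=
    (((ΦN.measurePreserving_restrict_good t₂).integrable_comp (hGwm t₂).aestronglyMeasurable).2
      ((hGwi t₂).mono_measure Measure.restrict_le_self)).const_mul _
  have hI3 : Integrable (fun z₀ => CW * Gw t₁ (ΦN.flow t₁ z₀)) (volume.restrict ΦN.good) :=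
    (((ΦN.measurePreserving_restrict_good t₁).integrable_comp (hGwm t₁).aestronglyMeasurable).2
      ((hGwi t₁).mono_measure Measure.restrict_le_self)).const_mul _
  have hI23 : Integrable (fun z₀ => CW * Gw t₂ (ΦN.flow t₂ z₀) + CW * Gw t₁ (ΦN.flow t₁ z₀))
      (volume.restrict ΦN.good) := hI2.add hI3
  have hboundi : Integrable (fun z₀ => 2 * (|W z₀| * NG.indicator 1 z₀) +
      (CW * Gw t₂ (ΦN.flow t₂ z₀) + CW * Gw t₁ (ΦN.flow t₁ z₀))) (volume.restrict ΦN.good) :=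
    hI1.add hI23
  have hNGint : ∫ z₀ in ΦN.good, |W z₀| * NG.indicator 1 z₀ = 0 := by
    have hnull := volume_good_inter_tagged_not_good_eq_zero Φs ΦN t₁ (m := m)
    rw [← hNG] at hnull
    refine setIntegral_eq_zero_of_ae_eq_zero ?_
    rw [ae_iff]
    refine measure_mono_null (fun z₀ hz₀ => ?_) hnull
    simp only [mem_setOf_eq, Classical.not_imp] at hz₀
    refine ⟨hz₀.1, ?_⟩
    by_contra hng
    exact hz₀.2 (by rw [indicator_of_notMem hng, mul_zero])
  have hGwint : ∀ t, ∫ z₀ in ΦN.good, Gw t (ΦN.flow t z₀) ≤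
      (t₂ - t₁) * A * ∫ Y in B, Real.exp (-(β / 2) * configEnergy Y) := by
    intro t
    rw [ΦN.setIntegral_comp_flow t (hGwm t)]
    have hEsm : Measurable fun Y : Config s d (UnitAddTorus d) => Real.exp (-(β / 2) * configEnergy Y) := by
      unfold configEnergy; fun_prop
    have hEsi : Integrable fun Y : Config s d (UnitAddTorus d) => Real.exp (-(β / 2) * configEnergy Y) :=
      integrable_exp_neg_mul_configEnergy (by positivity)
    calc ∫ z₀ in ΦN.good, Gw t z₀ ≤ ∫ z₀, Gw t z₀ :=
          setIntegral_le_integral (hGwi t) (Eventually.of_forall fun z => (hGw0 t z).1)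
      _ = (∫⁻ z₀, ENNReal.ofReal (Gw t z₀)).toReal :=
          integral_eq_lintegral_of_nonneg_ae (Eventually.of_forall fun z => (hGw0 t z).1)
            (hGwm t).aestronglyMeasurable
      _ ≤ (t₂ - t₁) * A * ∫ Y in Φs.flow t '' B, Real.exp (-(β / 2) * configEnergy Y) := by
          refine ENNReal.toReal_le_of_le_ofReal (by positivity) ?_
          have hlin := hA (t₂ - t₁) hh (Φs.flow t '' B) (hBt t)
          have hG' : ∀ z₀, ENNReal.ofReal (Gw t z₀) =
              (Φs.flow t '' B).indicator (1 : Config s d (UnitAddTorus d) → ℝ≥0∞) (z₀ ∘ Fin.castAdd m) *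
                {z : Config (s + m) d (UnitAddTorus d) | ∃ (i : Fin s) (j : Fin m),
                  ε ≤ Torus.euclidDist (z (Fin.castAdd m i)).1 (z (Fin.natAdd s j)).1 ∧
                    Torus.euclidDist (z (Fin.castAdd m i)).1 (z (Fin.natAdd s j)).1 ≤
                      ε + 2 * (t₂ - t₁) * Real.sqrt (2 * configEnergy z)}.indicator
                  (fun z => ENNReal.ofReal (Real.exp (-β * configEnergy z))) z₀ := by
            intro z₀
            rw [hGw]
            simp only
            by_cases h1 : (z₀ ∘ Fin.castAdd m : Config s d (UnitAddTorus d)) ∈ Φs.flow t '' B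
            · rw [indicator_of_mem h1, indicator_of_mem h1, Pi.one_apply, Pi.one_apply, one_mul, one_mul]
              by_cases h2 : z₀ ∈ {z : Config (s + m) d (UnitAddTorus d) | ∃ (i : Fin s) (j : Fin m),
                  ε ≤ Torus.euclidDist (z (Fin.castAdd m i)).1 (z (Fin.natAdd s j)).1 ∧
                    Torus.euclidDist (z (Fin.castAdd m i)).1 (z (Fin.natAdd s j)).1 ≤
                      ε + 2 * (t₂ - t₁) * Real.sqrt (2 * configEnergy z)}
              · rw [indicator_of_mem h2, indicator_of_mem h2]
              · rw [indicator_of_notMem h2, indicator_of_notMem h2, ENNReal.ofReal_zero]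
            · rw [indicator_of_notMem h1, indicator_of_notMem h1, zero_mul, zero_mul, ENNReal.ofReal_zero]
          calc ∫⁻ z₀, ENNReal.ofReal (Gw t z₀) = _ := lintegral_congr hG'
            _ ≤ _ := hlin
            _ = ENNReal.ofReal ((t₂ - t₁) * A * ∫ Y in Φs.flow t '' B, Real.exp (-(β / 2) * configEnergy Y)) := by
                rw [← ofReal_integral_eq_lintegral_ofReal hEsi.integrableOn
                  (Eventually.of_forall fun Y => (Real.exp_pos _).le), ← ENNReal.ofReal_mul (by positivity)]
      _ = (t₂ - t₁) * A * ∫ Y in B, Real.exp (-(β / 2) * configEnergy Y) := by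
          rw [Φs.setIntegral_image_flow_eq t hB hBg hEsm]
          congr 1
          refine setIntegral_congr_fun hB fun Y hY => ?_
          rw [Φs.configEnergy_flow (hBg hY) t]
  calc |∫ z₀ in ΦN.good, (ind t₂ z₀ * W z₀ - ind t₁ z₀ * W z₀)|
      ≤ ∫ z₀ in ΦN.good, |ind t₂ z₀ * W z₀ - ind t₁ z₀ * W z₀| := abs_integral_le_integral_abs
    _ ≤ ∫ z₀ in ΦN.good, (2 * (|W z₀| * NG.indicator 1 z₀) +
          (CW * Gw t₂ (ΦN.flow t₂ z₀) + CW * Gw t₁ (ΦN.flow t₁ z₀))) := by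
        refine integral_mono_of_nonneg (Eventually.of_forall fun _ => abs_nonneg _) hboundi ?_
        filter_upwards [ae_restrict_mem ΦN.measurableSet_good] with z₀ hz₀
        exact hpt z₀ hz₀
    _ = 2 * (∫ z₀ in ΦN.good, |W z₀| * NG.indicator 1 z₀) +
          (CW * (∫ z₀ in ΦN.good, Gw t₂ (ΦN.flow t₂ z₀)) + CW * (∫ z₀ in ΦN.good, Gw t₁ (ΦN.flow t₁ z₀))) := by
        rw [integral_add hI1 hI23, integral_add hI2 hI3, integral_const_mul, integral_const_mul,
          integral_const_mul]
    _ ≤ 2 * 0 + (CW * ((t₂ - t₁) * A * ∫ Y in B, Real.exp (-(β / 2) * configEnergy Y)) +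
          CW * ((t₂ - t₁) * A * ∫ Y in B, Real.exp (-(β / 2) * configEnergy Y))) := by
        rw [hNGint]
        gcongr
        · exact hGwint t₂
        · exact hGwint t₁
    _ = 2 * CW * A * (t₂ - t₁) * ∫ Y in B, Real.exp (-(β / 2) * configEnergy Y) := by ring

end Torus

end

end Literature.MathematicalPhysics.KineticTheory
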